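import Summits.QuantumFields.YangMills.Theorems.ChatterjeeMassGapTorusAxialBoxBit
import Summits.QuantumFields.YangMills.Theorems.ChatterjeeMassGapTorusAxialOneBitBoxIntegral
import HarnessLib

/-!
# S28ᵀ (Chatterjee torus-axial mass gap) — the (O2) obligation of the box fork, discharged for
`SU(2)` (ym-idea-4 g6, LINE-15)

Bears on rung S28ᵀ through the fork `S28BoxBit.gapCore_eventually_of_boxCumulant` (LINE-10):
island gap core ⟸ (O1) cumulant locality `p_Λ⁽⁸⁾(0) = 8!·κ_□` for `Λ ⊇ sites(B)` ∧
(O2) `κ_□ ≠ 0`. For `G = SU(2)` in the fundamental representation the box integral has now been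
COMPUTED in the tree by the prover seat ym-dw-p1 g6
(`S28OneBitBox.boxIntegral_plaquetteObs : ∫ ∏_{f ∈ ∂B} Re tr U_f dν = 1/256`, faces as a
`Finset (ZdPlaquette 4)`; `S28OneBitBox.integral_trace_re_eq_zero : m₀ = ∫ Re tr = 0`). This file
is the bridge to the fork's literal form:

* `boxCumulant_su2_eq` — the centred ten-fold product of `S28BoxBit` (its order, its `Pi.single`
  base points) integrates to `1/256` (`m₀ = 0`, base points normalised by `decide`, product
  reordered by `ring`);
* `boxCumulant_su2_ne_zero` — (O2) for `SU(2)`;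
* `gapCore_eventually_su2_of_boxLocality` — **for `SU(2)` the island gap core of S28ᵀ now follows
  from the single typed obligation (O1)** (cumulant locality of the eighth coefficient), and
  `gapCore_eventually_su2_of_coefficient` — equivalently from the one number
  `p_Λ⁽⁸⁾(0) = 315/2` for all finite regions `Λ ⊇ sites(B)`.

No summit is proved here: (O1) is open (prover lane ym-dw-p1 g6: replica expansion
`StrongCouplingObservableVanishing`; ideator blueprint O1O2-PLAN.md + LINE-11…14), and the island
gap core is one input of one conjunct (S28ᵀ), not the mass gap.
-/

noncomputable section

open MeasureTheory Filter Topology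
open Literature.MathematicalPhysics.QuantumLattice
open Literature.MathematicalPhysics.QuantumFieldTheory (expect zdHaar haarProbability)
open Literature.Probability.LatticeModels (Site HasInvCorrLength)

namespace Summit.QuantumFields.YangMills.Theorems.S28BoxBitSU2

open S28OneBitBox (lt01 lt02 lt12)

/-- **The box cumulant of `S28BoxBit` for `SU(2)`, fundamental representation, is `2⁻⁸`.**
[folklore] -/
theorem boxCumulant_su2_eq :
    (∫ U,
          (plaquetteObs (fundamentalRep (Fin 2)) (0 : Site 4) 1 2 U -
              ∫ g, ((fundamentalRep (Fin 2)) g).trace.re ∂(haarProbability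
                ↥(Matrix.specialUnitaryGroup (Fin 2) ℂ))) *
          (plaquetteObs (fundamentalRep (Fin 2)) (Pi.single 0 2 : Site 4) 1 2 U -
              ∫ g, ((fundamentalRep (Fin 2)) g).trace.re ∂(haarProbability
                ↥(Matrix.specialUnitaryGroup (Fin 2) ℂ))) *
          (plaquetteObs (fundamentalRep (Fin 2)) (0 : Site 4) 0 1 U -
              ∫ g, ((fundamentalRep (Fin 2)) g).trace.re ∂(haarProbability
                ↥(Matrix.specialUnitaryGroup (Fin 2) ℂ))) *
          (plaquetteObs (fundamentalRep (Fin 2)) (Pi.single 2 1 : Site 4) 0 1 U -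
              ∫ g, ((fundamentalRep (Fin 2)) g).trace.re ∂(haarProbability
                ↥(Matrix.specialUnitaryGroup (Fin 2) ℂ))) *
          (plaquetteObs (fundamentalRep (Fin 2)) (0 : Site 4) 0 2 U -
              ∫ g, ((fundamentalRep (Fin 2)) g).trace.re ∂(haarProbability
                ↥(Matrix.specialUnitaryGroup (Fin 2) ℂ))) *
          (plaquetteObs (fundamentalRep (Fin 2)) (Pi.single 1 1 : Site 4) 0 2 U -
              ∫ g, ((fundamentalRep (Fin 2)) g).trace.re ∂(haarProbability
                ↥(Matrix.specialUnitaryGroup (Fin 2) ℂ))) *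
          (plaquetteObs (fundamentalRep (Fin 2)) (Pi.single 0 1 : Site 4) 0 1 U -
              ∫ g, ((fundamentalRep (Fin 2)) g).trace.re ∂(haarProbability
                ↥(Matrix.specialUnitaryGroup (Fin 2) ℂ))) *
          (plaquetteObs (fundamentalRep (Fin 2)) (Pi.single 0 1 + Pi.single 2 1 : Site 4) 0 1 U -
              ∫ g, ((fundamentalRep (Fin 2)) g).trace.re ∂(haarProbability
                ↥(Matrix.specialUnitaryGroup (Fin 2) ℂ))) *
          (plaquetteObs (fundamentalRep (Fin 2)) (Pi.single 0 1 : Site 4) 0 2 U -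
              ∫ g, ((fundamentalRep (Fin 2)) g).trace.re ∂(haarProbability
                ↥(Matrix.specialUnitaryGroup (Fin 2) ℂ))) *
          (plaquetteObs (fundamentalRep (Fin 2)) (Pi.single 0 1 + Pi.single 1 1 : Site 4) 0 2 U -
              ∫ g, ((fundamentalRep (Fin 2)) g).trace.re ∂(haarProbability
                ↥(Matrix.specialUnitaryGroup (Fin 2) ℂ))) ∂(zdHaar 4 ↥(Matrix.specialUnitaryGroup
                (Fin 2) ℂ))) = 1 / 256 := by
  rw [S28OneBitBox.integral_trace_re_eq_zero]
  simp only [sub_zero]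
  rw [← S28OneBitBox.boxIntegral_plaquetteObs]
  refine integral_congr_ae (Eventually.of_forall fun U => ?_)
  beta_reduce
  rw [Finset.prod_insert (by decide +kernel), Finset.prod_insert (by decide +kernel),
    Finset.prod_insert (by decide +kernel), Finset.prod_insert (by decide +kernel),
    Finset.prod_insert (by decide +kernel), Finset.prod_insert (by decide +kernel),
    Finset.prod_insert (by decide +kernel), Finset.prod_insert (by decide +kernel),
    Finset.prod_insert (by decide +kernel), Finset.prod_singleton]
  have e0 : (0 : Site 4) = ![0,0,0,0] := by decide +kernel
  have e1 : (Pi.single 0 2 : Site 4) = ![2,0,0,0] := by decide +kernel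
  have e2 : (Pi.single 2 1 : Site 4) = ![0,0,1,0] := by decide +kernel
  have e3 : (Pi.single 1 1 : Site 4) = ![0,1,0,0] := by decide +kernel
  have e4 : (Pi.single 0 1 : Site 4) = ![1,0,0,0] := by decide +kernel
  have e5 : (Pi.single 0 1 + Pi.single 2 1 : Site 4) = ![1,0,1,0] := by decide +kernel
  have e6 : (Pi.single 0 1 + Pi.single 1 1 : Site 4) = ![1,1,0,0] := by decide +kernel
  rw [e5, e6, e1, e2, e3, e4, e0]
  ring

/-- **(O2) for `SU(2)`**: the box cumulant of `S28BoxBit` is non-zero. [folklore] -/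
theorem boxCumulant_su2_ne_zero :
    (∫ U,
          (plaquetteObs (fundamentalRep (Fin 2)) (0 : Site 4) 1 2 U -
              ∫ g, ((fundamentalRep (Fin 2)) g).trace.re ∂(haarProbability
                ↥(Matrix.specialUnitaryGroup (Fin 2) ℂ))) *
          (plaquetteObs (fundamentalRep (Fin 2)) (Pi.single 0 2 : Site 4) 1 2 U -
              ∫ g, ((fundamentalRep (Fin 2)) g).trace.re ∂(haarProbability
                ↥(Matrix.specialUnitaryGroup (Fin 2) ℂ))) *
          (plaquetteObs (fundamentalRep (Fin 2)) (0 : Site 4) 0 1 U -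
              ∫ g, ((fundamentalRep (Fin 2)) g).trace.re ∂(haarProbability
                ↥(Matrix.specialUnitaryGroup (Fin 2) ℂ))) *
          (plaquetteObs (fundamentalRep (Fin 2)) (Pi.single 2 1 : Site 4) 0 1 U -
              ∫ g, ((fundamentalRep (Fin 2)) g).trace.re ∂(haarProbability
                ↥(Matrix.specialUnitaryGroup (Fin 2) ℂ))) *
          (plaquetteObs (fundamentalRep (Fin 2)) (0 : Site 4) 0 2 U -
              ∫ g, ((fundamentalRep (Fin 2)) g).trace.re ∂(haarProbability
                ↥(Matrix.specialUnitaryGroup (Fin 2) ℂ))) *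
          (plaquetteObs (fundamentalRep (Fin 2)) (Pi.single 1 1 : Site 4) 0 2 U -
              ∫ g, ((fundamentalRep (Fin 2)) g).trace.re ∂(haarProbability
                ↥(Matrix.specialUnitaryGroup (Fin 2) ℂ))) *
          (plaquetteObs (fundamentalRep (Fin 2)) (Pi.single 0 1 : Site 4) 0 1 U -
              ∫ g, ((fundamentalRep (Fin 2)) g).trace.re ∂(haarProbability
                ↥(Matrix.specialUnitaryGroup (Fin 2) ℂ))) *
          (plaquetteObs (fundamentalRep (Fin 2)) (Pi.single 0 1 + Pi.single 2 1 : Site 4) 0 1 U -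
              ∫ g, ((fundamentalRep (Fin 2)) g).trace.re ∂(haarProbability
                ↥(Matrix.specialUnitaryGroup (Fin 2) ℂ))) *
          (plaquetteObs (fundamentalRep (Fin 2)) (Pi.single 0 1 : Site 4) 0 2 U -
              ∫ g, ((fundamentalRep (Fin 2)) g).trace.re ∂(haarProbability
                ↥(Matrix.specialUnitaryGroup (Fin 2) ℂ))) *
          (plaquetteObs (fundamentalRep (Fin 2)) (Pi.single 0 1 + Pi.single 1 1 : Site 4) 0 2 U -
              ∫ g, ((fundamentalRep (Fin 2)) g).trace.re ∂(haarProbability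
                ↥(Matrix.specialUnitaryGroup (Fin 2) ℂ))) ∂(zdHaar 4 ↥(Matrix.specialUnitaryGroup
                (Fin 2) ℂ))) ≠ 0 := by
  rw [boxCumulant_su2_eq]
  norm_num

/-- **For `SU(2)` the island gap core of S28ᵀ follows from (O1) alone.** If the eighth Taylor
coefficient at `β = 0` of the free-b.c. truncated correlation `p_Λ` of `Q = (0;1,2)` and
`P = (e₀;0,1)` equals `8! · κ_□` for every finite region containing the twelve sites of `B`, then
positivity and exponential decay of the axial plaquette correlation hold at every torus limit
point for all small `β > 0` (`S28BoxBit.gapCore_eventually_of_boxCumulant` with (O2) discharged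
by `boxCumulant_su2_ne_zero`). [folklore] -/
theorem gapCore_eventually_su2_of_boxLocality
    (hloc : ∀ Λ : Finset (Site 4),
      (Finset.univ : Finset (Fin 3 × Fin 2 × Fin 2)).image
          (fun v => (![((v.1 : ℕ) : ℤ), ((v.2.1 : ℕ) : ℤ), ((v.2.2 : ℕ) : ℤ), 0] : Site 4)) ⊆ Λ →
      iteratedDeriv 8 (fun t : ℝ =>
          (expect (fundamentalRep (Fin 2)) (fun U => ((plaquetteObs (fundamentalRep (Fin 2))
            (0 : Site 4) 1 2 U *
                plaquetteObs (fundamentalRep (Fin 2)) (Pi.single 0 1 : Site 4) 0 1 U : ℝ) : ℂ)) Λ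
                  t).re -
            (expect (fundamentalRep (Fin 2)) (fun U => (plaquetteObs (fundamentalRep (Fin 2))
              (0 : Site 4) 1 2 U : ℂ)) Λ t).re *
              (expect (fundamentalRep (Fin 2))
                (fun U => (plaquetteObs (fundamentalRep (Fin 2)) (Pi.single 0 1 : Site 4) 0 1 U
                  : ℂ)) Λ t).re)
          0 =
        40320 * ∫ U,
          (plaquetteObs (fundamentalRep (Fin 2)) (0 : Site 4) 1 2 U -
              ∫ g, ((fundamentalRep (Fin 2)) g).trace.re ∂(haarProbability
                ↥(Matrix.specialUnitaryGroup (Fin 2) ℂ))) *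
          (plaquetteObs (fundamentalRep (Fin 2)) (Pi.single 0 2 : Site 4) 1 2 U -
              ∫ g, ((fundamentalRep (Fin 2)) g).trace.re ∂(haarProbability
                ↥(Matrix.specialUnitaryGroup (Fin 2) ℂ))) *
          (plaquetteObs (fundamentalRep (Fin 2)) (0 : Site 4) 0 1 U -
              ∫ g, ((fundamentalRep (Fin 2)) g).trace.re ∂(haarProbability
                ↥(Matrix.specialUnitaryGroup (Fin 2) ℂ))) *
          (plaquetteObs (fundamentalRep (Fin 2)) (Pi.single 2 1 : Site 4) 0 1 U -
              ∫ g, ((fundamentalRep (Fin 2)) g).trace.re ∂(haarProbability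
                ↥(Matrix.specialUnitaryGroup (Fin 2) ℂ))) *
          (plaquetteObs (fundamentalRep (Fin 2)) (0 : Site 4) 0 2 U -
              ∫ g, ((fundamentalRep (Fin 2)) g).trace.re ∂(haarProbability
                ↥(Matrix.specialUnitaryGroup (Fin 2) ℂ))) *
          (plaquetteObs (fundamentalRep (Fin 2)) (Pi.single 1 1 : Site 4) 0 2 U -
              ∫ g, ((fundamentalRep (Fin 2)) g).trace.re ∂(haarProbability
                ↥(Matrix.specialUnitaryGroup (Fin 2) ℂ))) *
          (plaquetteObs (fundamentalRep (Fin 2)) (Pi.single 0 1 : Site 4) 0 1 U -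
              ∫ g, ((fundamentalRep (Fin 2)) g).trace.re ∂(haarProbability
                ↥(Matrix.specialUnitaryGroup (Fin 2) ℂ))) *
          (plaquetteObs (fundamentalRep (Fin 2)) (Pi.single 0 1 + Pi.single 2 1 : Site 4) 0 1 U -
              ∫ g, ((fundamentalRep (Fin 2)) g).trace.re ∂(haarProbability
                ↥(Matrix.specialUnitaryGroup (Fin 2) ℂ))) *
          (plaquetteObs (fundamentalRep (Fin 2)) (Pi.single 0 1 : Site 4) 0 2 U -
              ∫ g, ((fundamentalRep (Fin 2)) g).trace.re ∂(haarProbability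
                ↥(Matrix.specialUnitaryGroup (Fin 2) ℂ))) *
          (plaquetteObs (fundamentalRep (Fin 2)) (Pi.single 0 1 + Pi.single 1 1 : Site 4) 0 2 U -
              ∫ g, ((fundamentalRep (Fin 2)) g).trace.re ∂(haarProbability
                ↥(Matrix.specialUnitaryGroup (Fin 2) ℂ))) ∂(zdHaar 4 ↥(Matrix.specialUnitaryGroup
                (Fin 2) ℂ))) :
    ∀ᶠ β in 𝓝[>] (0 : ℝ), ∀ μ ∈ infiniteVolumeLimitPoints (d := 4) (fundamentalRep (Fin 2)) β,
      (∀ n : ℕ, 0 < plaquetteCorrFn (fundamentalRep (Fin 2)) μ ((n : ℤ) • Pi.single (0 : Fin 4)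
        (1 : ℤ))) ∧
        ∃ m : ℝ, 0 < m ∧ HasInvCorrLength (plaquetteCorrFn (fundamentalRep (Fin 2)) μ) m :=
  S28BoxBit.gapCore_eventually_of_boxCumulant (fundamentalRep (Fin 2)) (continuous_fundamentalRep
    (Fin 2)) hloc
    boxCumulant_su2_ne_zero

/-- **Numeric form.** For `SU(2)` the island gap core of S28ᵀ follows from the one number
`p_Λ⁽⁸⁾(0) = 315/2 (= 8!/256)` for all finite regions `Λ ⊇ sites(B)`
(`S28OneBitFiniteVolume.gapCore_eventually_of_freeCoefficient_of_forall`). [folklore] -/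
theorem gapCore_eventually_su2_of_coefficient
    (hcoef : ∀ Λ : Finset (Site 4),
      (Finset.univ : Finset (Fin 3 × Fin 2 × Fin 2)).image
          (fun v => (![((v.1 : ℕ) : ℤ), ((v.2.1 : ℕ) : ℤ), ((v.2.2 : ℕ) : ℤ), 0] : Site 4)) ⊆ Λ →
      iteratedDeriv 8 (fun t : ℝ =>
          (expect (fundamentalRep (Fin 2)) (fun U => ((plaquetteObs (fundamentalRep (Fin 2))
            (0 : Site 4) 1 2 U *
                plaquetteObs (fundamentalRep (Fin 2)) (Pi.single 0 1 : Site 4) 0 1 U : ℝ) : ℂ)) Λ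
                  t).re -
            (expect (fundamentalRep (Fin 2)) (fun U => (plaquetteObs (fundamentalRep (Fin 2))
              (0 : Site 4) 1 2 U : ℂ)) Λ t).re *
              (expect (fundamentalRep (Fin 2))
                (fun U => (plaquetteObs (fundamentalRep (Fin 2)) (Pi.single 0 1 : Site 4) 0 1 U
                  : ℂ)) Λ t).re)
          0 = 315 / 2) :
    ∀ᶠ β in 𝓝[>] (0 : ℝ), ∀ μ ∈ infiniteVolumeLimitPoints (d := 4) (fundamentalRep (Fin 2)) β,
      (∀ n : ℕ, 0 < plaquetteCorrFn (fundamentalRep (Fin 2)) μ ((n : ℤ) • Pi.single (0 : Fin 4)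
        (1 : ℤ))) ∧
        ∃ m : ℝ, 0 < m ∧ HasInvCorrLength (plaquetteCorrFn (fundamentalRep (Fin 2)) μ) m :=
  S28OneBitFiniteVolume.gapCore_eventually_of_freeCoefficient_of_forall (fundamentalRep (Fin 2))
    (continuous_fundamentalRep (Fin 2)) 8 _ fun Λ hΛ => by
    rw [hcoef Λ hΛ]
    norm_num

/-- Consistency of the two forms: `8! · κ_□ = 315/2` for `SU(2)`. [folklore] -/
theorem boxCoefficient_su2 :
    (40320 : ℝ) * ∫ U,
          (plaquetteObs (fundamentalRep (Fin 2)) (0 : Site 4) 1 2 U -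
              ∫ g, ((fundamentalRep (Fin 2)) g).trace.re ∂(haarProbability
                ↥(Matrix.specialUnitaryGroup (Fin 2) ℂ))) *
          (plaquetteObs (fundamentalRep (Fin 2)) (Pi.single 0 2 : Site 4) 1 2 U -
              ∫ g, ((fundamentalRep (Fin 2)) g).trace.re ∂(haarProbability
                ↥(Matrix.specialUnitaryGroup (Fin 2) ℂ))) *
          (plaquetteObs (fundamentalRep (Fin 2)) (0 : Site 4) 0 1 U -
              ∫ g, ((fundamentalRep (Fin 2)) g).trace.re ∂(haarProbability
                ↥(Matrix.specialUnitaryGroup (Fin 2) ℂ))) *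
          (plaquetteObs (fundamentalRep (Fin 2)) (Pi.single 2 1 : Site 4) 0 1 U -
              ∫ g, ((fundamentalRep (Fin 2)) g).trace.re ∂(haarProbability
                ↥(Matrix.specialUnitaryGroup (Fin 2) ℂ))) *
          (plaquetteObs (fundamentalRep (Fin 2)) (0 : Site 4) 0 2 U -
              ∫ g, ((fundamentalRep (Fin 2)) g).trace.re ∂(haarProbability
                ↥(Matrix.specialUnitaryGroup (Fin 2) ℂ))) *
          (plaquetteObs (fundamentalRep (Fin 2)) (Pi.single 1 1 : Site 4) 0 2 U -
              ∫ g, ((fundamentalRep (Fin 2)) g).trace.re ∂(haarProbability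
                ↥(Matrix.specialUnitaryGroup (Fin 2) ℂ))) *
          (plaquetteObs (fundamentalRep (Fin 2)) (Pi.single 0 1 : Site 4) 0 1 U -
              ∫ g, ((fundamentalRep (Fin 2)) g).trace.re ∂(haarProbability
                ↥(Matrix.specialUnitaryGroup (Fin 2) ℂ))) *
          (plaquetteObs (fundamentalRep (Fin 2)) (Pi.single 0 1 + Pi.single 2 1 : Site 4) 0 1 U -
              ∫ g, ((fundamentalRep (Fin 2)) g).trace.re ∂(haarProbability
                ↥(Matrix.specialUnitaryGroup (Fin 2) ℂ))) *
          (plaquetteObs (fundamentalRep (Fin 2)) (Pi.single 0 1 : Site 4) 0 2 U -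
              ∫ g, ((fundamentalRep (Fin 2)) g).trace.re ∂(haarProbability
                ↥(Matrix.specialUnitaryGroup (Fin 2) ℂ))) *
          (plaquetteObs (fundamentalRep (Fin 2)) (Pi.single 0 1 + Pi.single 1 1 : Site 4) 0 2 U -
              ∫ g, ((fundamentalRep (Fin 2)) g).trace.re ∂(haarProbability
                ↥(Matrix.specialUnitaryGroup (Fin 2) ℂ))) ∂(zdHaar 4 ↥(Matrix.specialUnitaryGroup
                (Fin 2) ℂ)) = 315 / 2 := by
  rw [boxCumulant_su2_eq]
  norm_num

end Summit.QuantumFields.YangMills.Theorems.S28BoxBitSU2
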